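import Mathlib
import Literature.NumberTheory.LFunctions.Zhang2022.TypedSection12B
import Literature.NumberTheory.LFunctions.Zhang2022.Section8Lemma82
import HarnessLib

/-!
# Zhang (2022), §12 Lemma 12.1 (p. 68): the `l`-sum `Σ_l χ(l)ϰ₁₃(dl)l^{β_j−1}` on `P″₁ < d < P₂`
# in closed form under (A) — node `Z22:§12.u020` DISCHARGED

Topic `Literature/NumberTheory/LFunctions/Zhang2022` (Landau–Siegel audit tree; verdict-neutral;
campaign D-0069, layer L3, discharge of the typed proof step `Typed.Sec12B.U020` of
`TypedSection12B.lean`). Y. Zhang, *Discrete mean estimates and the Landau–Siegel zero*,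
arXiv:2211.02515v1 (2022) [Zhang2022LandauSiegel] — **an unrefereed manuscript under adjudication;
this file PROVES one displayed step of its §12 from theorems of the tree and asserts nothing about
its Theorems 1–2.**

The step (proof of Lemma 12.1, p. 68, tex L3493–3497, DAG node `Z22:§12.u020`): for `P″₁ < d < P₂`
(`P″₁ = P^{0.496}Dt₀`, `P₂ = P^{1/2}T^{−10}`), "the sum becomes
`((d/P″₁)^{−β₆}log(d/P″₁)/log P₁)Σ_{l<P″₂/d} χ(l)/l^{1+β₆−β_j}
 + ((d/P″₁)^{−β₆}/log P₁)Σ_{l<P″₂/d} χ(l)log l/l^{1+β₆−β_j} + O(T^{−c})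
 = (L′(1,χ)(d/P″₁)^{−β₆}/log P₁)(−1 + (β₆ − β_j)log(d/P″₁)) + O(𝓛⁻¹⁵)`."

| decl | content |
|---|---|
| `sum121_eq_line020` | the `l`-sum IS the first line (the cut-off `P″₁ < dl < P″₂` is `l < P″₂/d`; the `O(T^{−c})` is `0`) |
| `sum_log_eq_log_mul_sub_twist`, `sum_Ico_ceil_eq_sum_range` | `Σ χ(l)log l·l^{−1−δ} = log X·Σχ(l)l^{−1−δ} − Σχ(l)l^{−1−δ}log(X/l)`; the plain sum as the head of `L(1+δ,χ)` |
| `U020_holds` | **the node holds**, for every real `c′` (explicit constant, `c = 1`) |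

Proof route (the manuscript's "similar to Lemma 8.2 … by Lemma 5.8 and a simple estimate", made
explicit): with `X = P″₂/d`, `δ = β₆ − β_j`, `u = log(d/P″₁)`, `Λ = u + log X = log(P″₂/P″₁) =
0.004·log P`, the first line is `((d/P″₁)^{−β₆}/log P₁)·(ΛA − B)` with `A = Σ_{l<X}χ(l)l^{−1−δ}`,
`B = Σ_{l≤X}χ(l)l^{−1−δ}log(X/l)`; the tree gives `B = L′(1,χ)(1 + δ log X) + O(𝓛⁻⁶)`
(`Lemma82.sum_twist_log_sub_main_le`, valid as `T ≤ X ≤ P`), `A = L(1+δ,χ) + O(D/X)`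
(`RichertFromExpSum.norm_LFunction_sub_sum_range_le`, `X > Dt₀T¹⁰`) and
`L(1+δ,χ) = L′(1,χ)δ + O(𝓛⁻¹⁵)` (`Lemma58.lemma_5_8_of_le`); since `|(d/P″₁)^{−β₆}| = 1` and
`log P₁ = 0.504𝓛⁹`, the total error is `O(𝓛⁻¹⁵)`. No named fact is used; axioms standard.

What this is NOT: a discharge of Lemma 12.1 itself (`Skeleton.Lemma121 c′`, whose third clause
carries the printed rounding claim `|ε₁ⱼ(d)| < 10⁻⁵` after the further linearisation
`(d/P″₁)^{−β₆} = 1 − β₆log(d/P″₁) + …`; that comparison is the business of a companion file), nor any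
statement about Theorems 1–2 or Landau–Siegel zeros.

## References

* Y. Zhang, arXiv:2211.02515v1 (2022), §12, proof of Lemma 12.1, p. 68.
  [cite: Zhang2022LandauSiegel, §12 Lemma 12.1, p. 68]
-/

noncomputable section

open Complex Real ComplexConjugate

namespace Literature.NumberTheory.LFunctions.Zhang2022.Typed.Sec12B

open Literature.NumberTheory.LFunctions.Zhang2022.Skeleton

/-! ### Step 1: for `P″₁ < d` the `l`-sum IS the first displayed line (no `O(T^{-c})` needed) -/

section StepOne

variable (c' : ℝ) {D : ℕ} (χ : DirichletCharacter ℂ D)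

/-- `z^{−b}/z^{1−a} = 1/z^{1+b−a}` for `z ≠ 0`. [folklore] -/
private theorem cpow_neg_div_cpow_one_sub {z : ℂ} (hz : z ≠ 0) (a b : ℂ) :
    z ^ (-b) / z ^ (1 - a) = 1 / z ^ (1 + b - a) := by
  have h1 : z ^ (1 - a) ≠ 0 := by
    rw [Complex.cpow_def_of_ne_zero hz]; exact Complex.exp_ne_zero _
  have h2 : z ^ (1 + b - a) ≠ 0 := by
    rw [Complex.cpow_def_of_ne_zero hz]; exact Complex.exp_ne_zero _
  rw [div_eq_div_iff h1 h2, one_mul, ← Complex.cpow_add _ _ hz]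
  congr 1; ring

/-- `P″₂ = P^{1/2}Dt₀ > 0` for `D ≥ 3`. [cite: Zhang2022LandauSiegel, §12 p. 67] -/
theorem P2pp_pos (hD : 3 ≤ D) : 0 < P2pp D := by
  have hD' : (3 : ℝ) ≤ D := by exact_mod_cast hD
  have hlog : 0 < ell D := by
    rw [ell]; exact Real.log_pos (by linarith)
  have ht0 : 0 < t0 D := by rw [t0]; exact pow_pos hlog _
  have hP : 0 < bigP D ^ (0.5 : ℝ) := Real.rpow_pos_of_pos (Real.exp_pos _) _
  rw [P2pp]
  positivity

/-- **Z22:§12.u020, first approximation, EXACTLY**: for `1 ≤ d` with `P″₁ < d` the `l`-sum of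
Lemma 12.1 equals the first displayed line of its proof (the cut-off `ϰ₁₃(dl) ≠ 0 ⟺ P″₁ < dl < P″₂`
becomes `l < P″₂/d`, and `(dl/P″₁)^{−β₆}log(dl/P″₁) = (d/P″₁)^{−β₆}l^{−β₆}(log(d/P″₁) + log l)`); in
particular the printed `+ O(T^{−c})` is `0`. [cite: Zhang2022LandauSiegel, §12 proof of Lemma 12.1,
p. 68] -/
theorem sum121_eq_line020 (hD : 3 ≤ D) (j : ℕ) {d : ℕ} (hd : 1 ≤ d) (hd1 : P1pp D < d) :
    sum121 c' χ j d = line020 c' χ j d := by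
  have hP1pp : 0 < P1pp D := P1pp_pos hD
  have hP2pp : 0 < P2pp D := P2pp_pos hD
  have hd0 : (0 : ℝ) < d := by exact_mod_cast hd
  have hdP : 0 < (d : ℝ) / P1pp D := div_pos hd0 hP1pp
  set X : ℝ := P2pp D / d with hX
  set cd : ℂ := (((d : ℝ) / P1pp D : ℝ) : ℂ) with hcd
  set u : ℝ := Real.log ((d : ℝ) / P1pp D) with hu
  set e : ℂ := 1 + beta6 D - betaJ c' D j with he
  -- the summand, for `1 ≤ l < X`
  have hterm : ∀ l ∈ Finset.Ico 1 ⌈X⌉₊,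
      χ (l : ZMod D) * vk13 D (d * l) / (l : ℂ) ^ (1 - betaJ c' D j) =
        cd ^ (-beta6 D) * (u : ℂ) / (Real.log (Skeleton.P1 D) : ℂ) *
            (χ (l : ZMod D) / (l : ℂ) ^ e) +
          cd ^ (-beta6 D) / (Real.log (Skeleton.P1 D) : ℂ) *
            (χ (l : ZMod D) * (Real.log l : ℂ) / (l : ℂ) ^ e) := by
    intro l hl
    rw [Finset.mem_Ico] at hl
    have hl1 : 1 ≤ l := hl.1
    have hlX : (l : ℝ) < X := Nat.lt_ceil.mp hl.2
    have hl0 : (0 : ℝ) < l := by exact_mod_cast hl1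
    have hlC : (l : ℂ) ≠ 0 := by exact_mod_cast (Nat.pos_iff_ne_zero.mp hl1)
    have hcond : P1pp D < ((d * l : ℕ) : ℝ) ∧ ((d * l : ℕ) : ℝ) < P2pp D := by
      constructor
      · calc P1pp D < d := hd1
          _ = (d : ℝ) * 1 := (mul_one _).symm
          _ ≤ (d : ℝ) * l := by gcongr; exact_mod_cast hl1
          _ = ((d * l : ℕ) : ℝ) := by push_cast; ring
      · have : (l : ℝ) * d < P2pp D := (lt_div_iff₀ hd0).mp hlX
        push_cast; linarith [mul_comm (l : ℝ) d]
    have hv : vk13 D (d * l) = ((Real.log (Skeleton.P1 D))⁻¹ : ℝ) *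
        ((((d * l : ℕ) : ℝ) / P1pp D : ℝ) : ℂ) ^ (-beta6 D) *
          (Real.log (((d * l : ℕ) : ℝ) / P1pp D) : ℂ) := by
      rw [vk13, if_pos hcond]
    have hsplit : (((d * l : ℕ) : ℝ) / P1pp D : ℝ) = (d : ℝ) / P1pp D * l := by
      push_cast; ring
    have hcpow : ((((d * l : ℕ) : ℝ) / P1pp D : ℝ) : ℂ) ^ (-beta6 D) =
        cd ^ (-beta6 D) * (l : ℂ) ^ (-beta6 D) := by
      rw [hsplit, Complex.ofReal_mul, Complex.mul_cpow_ofReal_nonneg hdP.le hl0.le,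
        Complex.ofReal_natCast]
    have hlog : Real.log (((d * l : ℕ) : ℝ) / P1pp D) = u + Real.log l := by
      rw [hsplit, Real.log_mul hdP.ne' hl0.ne']
    rw [hv, hcpow, hlog]
    have hq : (l : ℂ) ^ (-beta6 D) / (l : ℂ) ^ (1 - betaJ c' D j) = 1 / (l : ℂ) ^ e :=
      cpow_neg_div_cpow_one_sub hlC _ _
    have hinv : (((Real.log (Skeleton.P1 D))⁻¹ : ℝ) : ℂ) = ((Real.log (Skeleton.P1 D) : ℂ))⁻¹ :=
      Complex.ofReal_inv _
    rw [hinv]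
    calc χ (l : ZMod D) * (((Real.log (Skeleton.P1 D) : ℂ))⁻¹ *
            (cd ^ (-beta6 D) * (l : ℂ) ^ (-beta6 D)) * ((u + Real.log l : ℝ) : ℂ)) /
            (l : ℂ) ^ (1 - betaJ c' D j)
        = χ (l : ZMod D) * ((Real.log (Skeleton.P1 D) : ℂ))⁻¹ * cd ^ (-beta6 D) *
            ((u + Real.log l : ℝ) : ℂ) * ((l : ℂ) ^ (-beta6 D) / (l : ℂ) ^ (1 - betaJ c' D j)) := by
          ring
      _ = χ (l : ZMod D) * ((Real.log (Skeleton.P1 D) : ℂ))⁻¹ * cd ^ (-beta6 D) *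
            ((u + Real.log l : ℝ) : ℂ) * (1 / (l : ℂ) ^ e) := by rw [hq]
      _ = _ := by push_cast; ring
  -- the index sets: `ϰ₁₃(dl) = 0` unless `l < X`, and `⌈X⌉ ≤ ⌈P″₂⌉`
  have hsub : Finset.Ico 1 ⌈X⌉₊ ⊆ Finset.Ico 1 ⌈P2pp D⌉₊ := by
    apply Finset.Ico_subset_Ico_right
    apply Nat.ceil_mono
    rw [hX]
    calc P2pp D / d ≤ P2pp D / 1 := by
          apply div_le_div_of_nonneg_left hP2pp.le one_pos; exact_mod_cast hd
      _ = P2pp D := div_one _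
  have hzero : ∀ l ∈ Finset.Ico 1 ⌈P2pp D⌉₊, l ∉ Finset.Ico 1 ⌈X⌉₊ →
      χ (l : ZMod D) * vk13 D (d * l) / (l : ℂ) ^ (1 - betaJ c' D j) = 0 := by
    intro l hl hl'
    rw [Finset.mem_Ico] at hl
    rw [Finset.mem_Ico, not_and, not_lt] at hl'
    have hXl : X ≤ l := Nat.ceil_le.mp (hl' hl.1)
    have hcond : ¬ (P1pp D < ((d * l : ℕ) : ℝ) ∧ ((d * l : ℕ) : ℝ) < P2pp D) := by
      rintro ⟨-, h2⟩
      have : P2pp D ≤ (l : ℝ) * d := (div_le_iff₀ hd0).mp hXl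
      push_cast at h2; nlinarith
    rw [vk13, if_neg hcond]; simp
  rw [sum121, ← Finset.sum_subset hsub hzero, Finset.sum_congr rfl hterm, Finset.sum_add_distrib,
    ← Finset.mul_sum, ← Finset.mul_sum, line020]

end StepOne

/-! ### Step 2: the two character sums of the first line against `L(1+δ,χ)` and the tree's
Lemma 8.2 core -/

section StepTwo

variable {D : ℕ} (χ : DirichletCharacter ℂ D)

/-- Re-indexing `Σ_{1 ≤ l < ⌈X⌉}` as `Σ_{1 ≤ m ≤ ⌊X⌋}` when the summand vanishes at `l = X`.
[folklore] -/
private theorem sum_Ico_ceil_eq_sum_Ioc_floor {X : ℝ} (hX : 0 < X) (f : ℕ → ℂ)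
    (hf : ∀ m : ℕ, (m : ℝ) = X → f m = 0) :
    ∑ l ∈ Finset.Ico 1 ⌈X⌉₊, f l = ∑ m ∈ Finset.Ioc 0 ⌊X⌋₊, f m := by
  have hsub : Finset.Ico 1 ⌈X⌉₊ ⊆ Finset.Ioc 0 ⌊X⌋₊ := by
    intro m hm
    rw [Finset.mem_Ico] at hm
    rw [Finset.mem_Ioc]
    exact ⟨hm.1, Nat.le_floor (Nat.lt_ceil.mp hm.2).le⟩
  apply Finset.sum_subset hsub
  intro m hm hm'
  rw [Finset.mem_Ioc] at hm
  rw [Finset.mem_Ico, not_and, not_lt] at hm'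
  have hXm : X ≤ m := Nat.ceil_le.mp (hm' hm.1)
  have hmX : (m : ℝ) ≤ X := (Nat.le_floor_iff hX.le).mp hm.2
  exact hf m (le_antisymm hmX hXm)

/-- The `log l`-weighted sum through the tree's `log(X/l)`-weighted one:
`Σ_{l<X} χ(l) log l · l^{−1−δ} = log X · Σ_{l<X} χ(l)l^{−1−δ} − Σ_{l≤X} χ(l)l^{−1−δ}log(X/l)`
(the passage between the manuscript's `Σ χ(l)log l/l^{1+β₆−β_j}` and the log-weighted sum of its
Lemma 8.2). [cite: Zhang2022LandauSiegel, §12 proof of Lemma 12.1, p. 68] -/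
theorem sum_log_eq_log_mul_sub_twist {X : ℝ} (hX : 0 < X) (δ : ℂ) {e : ℂ} (he : e = 1 + δ) :
    ∑ l ∈ Finset.Ico 1 ⌈X⌉₊, χ (l : ZMod D) * (Real.log l : ℂ) / (l : ℂ) ^ e =
      (Real.log X : ℂ) * ∑ l ∈ Finset.Ico 1 ⌈X⌉₊, χ (l : ZMod D) / (l : ℂ) ^ e -
        ∑ m ∈ Finset.Ioc 0 ⌊X⌋₊, Lemma82.twist χ δ m * (Real.log (X / m) : ℂ) := by
  subst he
  have htw : ∑ m ∈ Finset.Ioc 0 ⌊X⌋₊, Lemma82.twist χ δ m * (Real.log (X / m) : ℂ) =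
      ∑ l ∈ Finset.Ico 1 ⌈X⌉₊, Lemma82.twist χ δ l * (Real.log (X / l) : ℂ) := by
    refine (sum_Ico_ceil_eq_sum_Ioc_floor hX _ fun m hm => ?_).symm
    have hm0 : (0 : ℝ) < m := by rw [hm]; exact hX
    rw [← hm, div_self hm0.ne', Real.log_one]
    simp
  rw [htw, Finset.mul_sum, ← Finset.sum_sub_distrib]
  refine Finset.sum_congr rfl fun l hl => ?_
  rw [Finset.mem_Ico] at hl
  have hl0 : (0 : ℝ) < l := by exact_mod_cast hl.1
  have hlC : (l : ℂ) ≠ 0 := by exact_mod_cast (Nat.pos_iff_ne_zero.mp hl.1)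
  have hlog : Real.log (X / l) = Real.log X - Real.log l := Real.log_div hX.ne' hl0.ne'
  have hpow : (l : ℂ) ^ (-1 - δ) = 1 / (l : ℂ) ^ (1 + δ) := by
    rw [show (-1 - δ : ℂ) = -(1 + δ) by ring, Complex.cpow_neg, one_div]
  rw [Lemma82.twist, hpow, hlog]
  push_cast
  ring

/-- The plain sum as the head of the Dirichlet series of `L(1+δ,χ)`:
`Σ_{1≤l<⌈X⌉} χ(l)l^{−(1+δ)} = Σ_{n<⌈X⌉−1} χ(n+1)(n+1)^{−(1+δ)}` (the manuscript's
`Σ_{l<P″₂/d} χ(l)/l^{1+β₆−β_j}`, "`P″₂/d > T¹⁰`"). [cite: Zhang2022LandauSiegel, §12 proof of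
Lemma 12.1, p. 68] -/
theorem sum_Ico_ceil_eq_sum_range (X : ℝ) (δ : ℂ) {e : ℂ} (he : e = 1 + δ) :
    ∑ l ∈ Finset.Ico 1 ⌈X⌉₊, χ (l : ZMod D) / (l : ℂ) ^ e =
      ∑ n ∈ Finset.range (⌈X⌉₊ - 1), χ ((n + 1 : ℕ) : ZMod D) * ((n + 1 : ℕ) : ℂ) ^ (-(1 + δ)) := by
  subst he
  rw [Finset.sum_Ico_eq_sum_range]
  refine Finset.sum_congr rfl fun n _ => ?_
  rw [Complex.cpow_neg, div_eq_mul_inv, add_comm 1 n]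

end StepTwo

/-! ### Step 3: the closed form — node `Z22:§12.u020` holds -/

section StepThree

/-- The first displayed line, factored: `line020 = ((d/P″₁)^{−β₆}/log P₁)·(log(d/P″₁)·ΣA + ΣB)`.
[cite: Zhang2022LandauSiegel, §12 proof of Lemma 12.1, p. 68] -/
theorem line020_eq_mul (c' : ℝ) {D : ℕ} (χ : DirichletCharacter ℂ D) (j d : ℕ) :
    line020 c' χ j d =
      ((d / P1pp D : ℝ) : ℂ) ^ (-beta6 D) / (Real.log (Skeleton.P1 D) : ℂ) *
        ((Real.log (d / P1pp D) : ℂ) *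
            ∑ l ∈ Finset.Ico 1 ⌈P2pp D / d⌉₊,
              χ (l : ZMod D) / (l : ℂ) ^ (1 + beta6 D - betaJ c' D j) +
          ∑ l ∈ Finset.Ico 1 ⌈P2pp D / d⌉₊,
            χ (l : ZMod D) * (Real.log l : ℂ) / (l : ℂ) ^ (1 + beta6 D - betaJ c' D j)) := by
  rw [line020]; ring

/-- The algebra of the comparison: with `u + log X = Λ`,
`u·A + (log X·A − B) − L′(−1 + δu) = Λ(A − L′δ) − (B − L′(1 + δ log X))`. [folklore] -/
private theorem inner_identity (A Bt L1 δ : ℂ) {u lX Λ : ℝ} (h : u + lX = Λ) :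
    (u : ℂ) * A + ((lX : ℂ) * A - Bt) - L1 * (-1 + δ * (u : ℂ)) =
      (Λ : ℂ) * (A - L1 * δ) - (Bt - L1 * (1 + δ * (lX : ℂ))) := by
  have : (u : ℂ) = (Λ : ℂ) - (lX : ℂ) := by rw [← h]; push_cast; ring
  rw [this]; ring

/-- The triangle inequality for the comparison. [folklore] -/
private theorem inner_bound {A Bt L1 Lv δ : ℂ} {lX Λ a b c : ℝ} (hΛ : 0 ≤ Λ)
    (ha : ‖A - Lv‖ ≤ a) (hb : ‖Lv - L1 * δ‖ ≤ b) (hc : ‖Bt - L1 * (1 + δ * (lX : ℂ))‖ ≤ c) :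
    ‖(Λ : ℂ) * (A - L1 * δ) - (Bt - L1 * (1 + δ * (lX : ℂ)))‖ ≤ Λ * (a + b) + c := by
  have hAδ : ‖A - L1 * δ‖ ≤ a + b := by
    calc ‖A - L1 * δ‖ = ‖(A - Lv) + (Lv - L1 * δ)‖ := by congr 1; ring
      _ ≤ ‖A - Lv‖ + ‖Lv - L1 * δ‖ := norm_add_le _ _
      _ ≤ a + b := add_le_add ha hb
  calc ‖(Λ : ℂ) * (A - L1 * δ) - (Bt - L1 * (1 + δ * (lX : ℂ)))‖
      ≤ ‖(Λ : ℂ) * (A - L1 * δ)‖ + ‖Bt - L1 * (1 + δ * (lX : ℂ))‖ := norm_sub_le _ _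
    _ ≤ Λ * (a + b) + c := by
        rw [norm_mul, Complex.norm_real, Real.norm_eq_abs, abs_of_nonneg hΛ]
        exact add_le_add (mul_le_mul_of_nonneg_left hAδ hΛ) hc

/-- The shifts `β_j` (2.13) are purely imaginary of size `≤ (3 + 5|c′|)α` (any real `c′`; for
`𝓛 ≥ 2`, where `α𝓛 ≤ 1`). [cite: Zhang2022LandauSiegel, §2 (2.13)] -/
private theorem betaJ_re_and_norm (c' : ℝ) {D : ℕ} (hL : 2 ≤ Real.log D) {j : ℕ}
    (hj : j ∈ ({1, 2, 3} : Finset ℕ)) :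
    (betaJ c' D j).re = 0 ∧ ‖betaJ c' D j‖ ≤ (3 + 5 * |c'|) * (π / Real.log D ^ 9) := by
  have hπ := Real.pi_pos
  have hL0 : 0 < Real.log D := by linarith
  have hα : alpha D = π / Real.log D ^ 9 := by rw [alpha, bigP, Real.log_exp, ell]
  set a : ℝ := π / Real.log D ^ 9 with ha
  have ha0 : 0 < a := by positivity
  have hell : ell D = Real.log D := rfl
  -- `α𝓛 = π/𝓛⁸ ≤ π/2⁸ ≤ 1`
  have haL : a * Real.log D ≤ 1 := by
    have h8 : (2 : ℝ) ^ 8 ≤ Real.log D ^ 8 := pow_le_pow_left₀ (by norm_num) hL 8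
    have hπ4 : π ≤ 4 := Real.pi_le_four
    rw [ha, div_mul_eq_mul_div, div_le_one (by positivity)]
    calc π * Real.log D ≤ 4 * Real.log D := by nlinarith
      _ ≤ 2 ^ 8 * Real.log D := by nlinarith
      _ ≤ Real.log D ^ 8 * Real.log D := by nlinarith
      _ = Real.log D ^ 9 := by ring
  have haL0 : 0 ≤ a * Real.log D := by positivity
  have hc0 : 0 ≤ |c'| := abs_nonneg _
  have hcaL : |c'| * (a * Real.log D) ≤ |c'| := by nlinarith
  simp only [Finset.mem_insert, Finset.mem_singleton] at hj
  rcases hj with rfl | rfl | rfl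
  · have he : betaJ c' D 1 = ((a * (1 - 5 * c' * a * Real.log D) : ℝ) : ℂ) * I := by
      simp only [betaJ, Nat.reduceMod, if_true, beta1, hα, hell]
      push_cast; ring
    refine ⟨by rw [he]; exact Lemma82.re_ofReal_mul_I _, ?_⟩
    rw [he, Lemma82.norm_ofReal_mul_I, abs_mul, abs_of_pos ha0]
    have h1 : |1 - 5 * c' * a * Real.log D| ≤ 1 + 5 * |c'| := by
      calc |1 - 5 * c' * a * Real.log D| ≤ |(1 : ℝ)| + |5 * c' * a * Real.log D| := abs_sub _ _
        _ = 1 + 5 * (|c'| * (a * Real.log D)) := by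
            rw [abs_one, show 5 * c' * a * Real.log D = 5 * (c' * (a * Real.log D)) by ring,
              abs_mul, abs_mul, abs_of_nonneg haL0, abs_of_pos (by norm_num : (0 : ℝ) < 5)]
        _ ≤ 1 + 5 * |c'| := by linarith
    nlinarith
  · have he : betaJ c' D 2 = ((2 * a * (1 + c' * a * Real.log D) : ℝ) : ℂ) * I := by
      simp only [betaJ, Nat.reduceMod, beta2, hα, hell]
      norm_num; ring
    refine ⟨by rw [he]; exact Lemma82.re_ofReal_mul_I _, ?_⟩
    rw [he, Lemma82.norm_ofReal_mul_I, abs_mul, abs_of_pos (by positivity : (0 : ℝ) < 2 * a)]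
    have h1 : |1 + c' * a * Real.log D| ≤ 1 + |c'| := by
      calc |1 + c' * a * Real.log D| ≤ |(1 : ℝ)| + |c' * a * Real.log D| := abs_add_le _ _
        _ = 1 + |c'| * (a * Real.log D) := by
            rw [abs_one, show c' * a * Real.log D = c' * (a * Real.log D) by ring, abs_mul,
              abs_of_nonneg haL0]
        _ ≤ 1 + |c'| := by linarith
    nlinarith
  · have he : betaJ c' D 3 = ((3 * a * (1 - c' * a * Real.log D) : ℝ) : ℂ) * I := by
      simp only [betaJ, Nat.reduceMod, beta3, hα, hell]
      norm_num; ring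
    refine ⟨by rw [he]; exact Lemma82.re_ofReal_mul_I _, ?_⟩
    rw [he, Lemma82.norm_ofReal_mul_I, abs_mul, abs_of_pos (by positivity : (0 : ℝ) < 3 * a)]
    have h1 : |1 - c' * a * Real.log D| ≤ 1 + |c'| := by
      calc |1 - c' * a * Real.log D| ≤ |(1 : ℝ)| + |c' * a * Real.log D| := abs_sub _ _
        _ = 1 + |c'| * (a * Real.log D) := by
            rw [abs_one, show c' * a * Real.log D = c' * (a * Real.log D) by ring, abs_mul,
              abs_of_nonneg haL0]
        _ ≤ 1 + |c'| := by linarith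
    nlinarith

variable (c' : ℝ)

/-- **Z22:§12.u020 HOLDS (for every value of the manuscript's constant `c′`)**: on `P″₁ < d < P₂`, under (A), the
`l`-sum of Lemma 12.1 equals its first displayed line EXACTLY and
`= (L′(1,χ)(d/P″₁)^{−β₆}/log P₁)(−1 + (β₆ − β_j)log(d/P″₁)) + O(𝓛⁻¹⁵)` — kernel-checked from the
tree's Lemma 8.2 core (`Lemma82.sum_twist_log_sub_main_le`, applicable because `T ≤ P″₂/d ≤ P` on
this range), Lemma 5.8 (`Lemma58.lemma_5_8_of_le`, `L(1+δ,χ) = L′(1,χ)δ + O(𝓛⁻¹⁵)`) and the tail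
of the Dirichlet series of `L(1+δ,χ)` beyond `P″₂/d > Dt₀T¹⁰`
(`RichertFromExpSum.norm_LFunction_sub_sum_range_le`), via the identity
`log(dl/P″₁) = log(P″₂/P″₁) − log((P″₂/d)/l)`, `log(P″₂/P″₁) = 0.004·log P`. This is the
manuscript's own intermediate display (proof of Lemma 12.1, p. 68, tex L3493–3497); the node is
DISCHARGED (constant `(0.004·C₅₈ + 1 + C₈₂)/0.504` with the tree's `C82`, threshold
`D ≥ ⌈exp(8(3+5|c′|)π + 3)⌉`).
[cite: Zhang2022LandauSiegel, §12 proof of Lemma 12.1, p. 68] -/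
theorem U020_holds : U020 c' := by
  set K : ℝ := 2 * (3 + 5 * |c'|) with hKdef
  have hK0 : 0 ≤ K := by rw [hKdef]; positivity
  set C58 : ℝ := 1 + 16 * Real.exp (9 / 2) * π ^ 2 * K ^ 2 with hC58
  set CE : ℝ := 0.004 * C58 + 1 + Lemma82.C82 K with hCE
  refine ⟨1, one_pos, CE / 0.504, ⌈Real.exp (4 * K * π + 3)⌉₊,
    fun D _ χ hD hq hp hA j hj d hd hd1 hd2 => ?_⟩
  have hπ := Real.pi_pos
  -- `D` large: `𝓛 ≥ 3`, `4Kπ ≤ 𝓛 ≤ 𝓛⁸`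
  have hD0 : (0 : ℝ) < D := lt_of_lt_of_le (Real.exp_pos _)
    (le_trans (Nat.le_ceil _) (by exact_mod_cast hD))
  have hexp : Real.exp (4 * K * π + 3) ≤ D := le_trans (Nat.le_ceil _) (by exact_mod_cast hD)
  have hlogD : 4 * K * π + 3 ≤ Real.log D := (Real.le_log_iff_exp_le hD0).mpr hexp
  have hKπ : 0 ≤ 4 * K * π := by positivity
  have hL3 : 3 ≤ Real.log D := by linarith only [hlogD, hKπ]
  have hL1 : 1 ≤ Real.log D := by linarith only [hL3]
  have hL0 : 0 < Real.log D := by linarith only [hL3]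
  have hK8 : 4 * K * π ≤ Real.log D ^ 8 := by
    calc 4 * K * π ≤ Real.log D := by linarith only [hlogD]
      _ = Real.log D ^ 1 := (pow_one _).symm
      _ ≤ Real.log D ^ 8 := pow_le_pow_right₀ hL1 (by norm_num)
  have hK1 : K * π ≤ Real.log D ^ 8 := by nlinarith only [hK8, hK0, hπ]
  have hD3 : 3 ≤ D := by
    have h3 : Real.exp 3 ≤ Real.exp (4 * K * π + 3) := Real.exp_le_exp.mpr (by linarith only [hKπ])
    have h4 : (3 : ℝ) + 1 ≤ Real.exp 3 := Real.add_one_le_exp 3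
    have : (3 : ℝ) ≤ D := by linarith only [h3, h4, hexp]
    exact_mod_cast this
  have hD2 : 2 ≤ D := le_trans (by norm_num) hD3
  have hχ1 : χ ≠ 1 := Lemma31.ne_one_of_isPrimitive χ hD2 hp
  have hA' : ‖χ.LFunction 1‖ ≤ 1 / Real.log D ^ 2022 := le_of_lt hA
  have hell : ell D = Real.log D := rfl
  have hC82 : 0 ≤ Lemma82.C82 K := by
    have := Lemma82.I0_nonneg
    rw [Lemma82.C82]; positivity
  have hCE0 : 0 ≤ CE := by rw [hCE]; positivity
  constructor
  · -- (i) the sum IS the first line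
    rw [sum121_eq_line020 c' χ hD3 j hd hd1, sub_self, norm_zero]
    exact mul_nonneg (div_nonneg hCE0 (by norm_num)) (Real.rpow_nonneg (Real.exp_nonneg _) _)
  · -- (ii) the closed form
    -- parameters of the setting
    have hα : alpha D = π / Real.log D ^ 9 := by rw [alpha, bigP, Real.log_exp, hell]
    have hP : 0 < bigP D := Real.exp_pos _
    have hP1' : 1 ≤ bigP D := Real.one_le_exp (by rw [hell]; positivity)
    have hlogP1 : Real.log (Skeleton.P1 D) = 0.504 * Real.log D ^ 9 := by
      rw [Skeleton.P1, Real.log_rpow hP, bigP, Real.log_exp, hell]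
    have hP1pp : 0 < P1pp D := P1pp_pos hD3
    have hP2pp : 0 < P2pp D := P2pp_pos hD3
    have hd0 : (0 : ℝ) < d := by exact_mod_cast hd
    have hDr : (3 : ℝ) ≤ D := by exact_mod_cast hD3
    have ht0 : 1 ≤ t0 D := by rw [t0, hell]; exact one_le_pow₀ hL1
    have ht0eq : t0 D = Real.log D ^ 519 := by rw [t0, hell]
    have hT1 : 1 ≤ bigT D := Real.one_le_exp (by rw [hell]; positivity)
    have hT2 : 2 ≤ bigT D := by
      have h1 : (1 : ℝ) ≤ Real.log D ^ (1.1 : ℝ) := Real.one_le_rpow hL1 (by norm_num)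
      have h2 : Real.exp 1 ≤ Real.exp (Real.log D ^ (1.1 : ℝ)) := Real.exp_le_exp.mpr h1
      have h3 : (1 : ℝ) + 1 ≤ Real.exp 1 := Real.add_one_le_exp 1
      rw [bigT, hell]; linarith only [h2, h3]
    have hDt0 : 1 ≤ (D : ℝ) * t0 D := one_le_mul_of_one_le_of_one_le (by linarith only [hDr]) ht0
    obtain ⟨X, hX⟩ : ∃ X : ℝ, X = P2pp D / d := ⟨_, rfl⟩
    have hXlow : bigT D ^ 10 * ((D : ℝ) * t0 D) < X := by
      have h1 : (d : ℝ) * bigT D ^ 10 < bigP D ^ (0.5 : ℝ) := by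
        have := hd2
        rw [Skeleton.P2, lt_div_iff₀ (by positivity)] at this
        exact this
      rw [hX, lt_div_iff₀ hd0, P2pp]
      have hpos : (0 : ℝ) < (D : ℝ) * t0 D := by linarith only [hDt0]
      calc bigT D ^ 10 * ((D : ℝ) * t0 D) * d = ((d : ℝ) * bigT D ^ 10) * ((D : ℝ) * t0 D) := by
            ring
        _ < bigP D ^ (0.5 : ℝ) * ((D : ℝ) * t0 D) := mul_lt_mul_of_pos_right h1 hpos
        _ = bigP D ^ (0.5 : ℝ) * D * t0 D := by ring
    have hXT : bigT D ≤ X := by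
      calc bigT D = bigT D ^ 1 * 1 := by ring
        _ ≤ bigT D ^ 10 * ((D : ℝ) * t0 D) :=
            mul_le_mul (pow_le_pow_right₀ hT1 (by norm_num)) hDt0 zero_le_one (by positivity)
        _ ≤ X := hXlow.le
    have hX2 : 2 ≤ X := le_trans hT2 hXT
    have hX0 : 0 < X := by linarith only [hX2]
    have hratio : P2pp D / P1pp D = bigP D ^ (0.004 : ℝ) := by
      have hne : (D : ℝ) * t0 D ≠ 0 := by positivity
      have h1 : P2pp D / P1pp D = bigP D ^ (0.5 : ℝ) / bigP D ^ (0.496 : ℝ) := by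
        rw [P2pp, P1pp, mul_assoc, mul_assoc, mul_div_mul_right _ _ hne]
      rw [h1, ← Real.rpow_sub hP]
      norm_num
    have hXP : X ≤ bigP D := by
      have h1 : X < P2pp D / P1pp D := by
        rw [hX]; exact div_lt_div_of_pos_left hP2pp hP1pp hd1
      have h3 : bigP D ^ (0.004 : ℝ) ≤ bigP D := by
        calc bigP D ^ (0.004 : ℝ) ≤ bigP D ^ (1 : ℝ) :=
              Real.rpow_le_rpow_of_exponent_le hP1' (by norm_num)
          _ = bigP D := Real.rpow_one _
      rw [hratio] at h1
      linarith only [h1, h3]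
    obtain ⟨u, hu⟩ : ∃ u : ℝ, u = Real.log ((d : ℝ) / P1pp D) := ⟨_, rfl⟩
    have hdP : 0 < (d : ℝ) / P1pp D := div_pos hd0 hP1pp
    have hΛ : u + Real.log X = 0.004 * Real.log D ^ 9 := by
      rw [hu, ← Real.log_mul hdP.ne' hX0.ne']
      have : (d : ℝ) / P1pp D * X = P2pp D / P1pp D := by
        rw [hX]; field_simp
      rw [this, hratio, Real.log_rpow hP, bigP, Real.log_exp, hell]
    -- the shifts
    obtain ⟨δ, hδdef⟩ : ∃ δ : ℂ, δ = beta6 D - betaJ c' D j := ⟨_, rfl⟩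
    have he' : 1 + beta6 D - betaJ c' D j = 1 + δ := by rw [hδdef]; ring
    obtain ⟨hβjre, hβjn⟩ := betaJ_re_and_norm c' (by linarith only [hL3]) hj
    have hβ6eq : beta6 D = ((3 / 2 * (π / Real.log D ^ 9) : ℝ) : ℂ) * I := by
      rw [beta6, hα]; push_cast; ring
    have hβ6re : (beta6 D).re = 0 := by rw [hβ6eq]; exact Lemma82.re_ofReal_mul_I _
    have hβ6n : ‖beta6 D‖ ≤ (3 + 5 * |c'|) * (π / Real.log D ^ 9) := by
      rw [hβ6eq, Lemma82.norm_ofReal_mul_I, abs_of_pos (by positivity)]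
      have h0 : 0 ≤ π / Real.log D ^ 9 := by positivity
      have hc0 : 0 ≤ |c'| := abs_nonneg _
      nlinarith only [h0, hc0]
    have hδre : δ.re = 0 := by rw [hδdef, Complex.sub_re, hβ6re, hβjre, sub_zero]
    have hδ : ‖δ‖ ≤ K * π / Real.log D ^ 9 := by
      rw [hδdef]
      calc ‖beta6 D - betaJ c' D j‖ ≤ ‖beta6 D‖ + ‖betaJ c' D j‖ := norm_sub_le _ _
        _ ≤ (3 + 5 * |c'|) * (π / Real.log D ^ 9) + (3 + 5 * |c'|) * (π / Real.log D ^ 9) :=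
            add_le_add hβ6n hβjn
        _ = K * π / Real.log D ^ 9 := by rw [hKdef]; ring
    have hδ1 : ‖δ‖ ≤ 1 := by
      refine hδ.trans ?_
      rw [div_le_one (by positivity)]
      have h9 : Real.log D ^ 8 ≤ Real.log D ^ 9 := pow_le_pow_right₀ hL1 (by norm_num)
      linarith only [h9, hK1]
    have hre1 : (1 + δ).re = 1 := by
      rw [Complex.add_re, Complex.one_re, hδre, add_zero]
    have hs : 0 < (1 + δ).re := by rw [hre1]; exact one_pos
    have hn1δ : ‖(1 : ℂ) + δ‖ ≤ 2 := by
      have h := norm_add_le (1 : ℂ) δ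
      rw [norm_one] at h
      linarith only [h, hδ1]
    -- (b2) `N = ⌈X⌉ − 1 ≥ X − 1 ≥ X/2`, and `X > Dt₀T¹⁰`
    obtain ⟨N, hN⟩ : ∃ N : ℕ, N = ⌈X⌉₊ - 1 := ⟨_, rfl⟩
    have hceil2 : 2 ≤ ⌈X⌉₊ := by
      have : (2 : ℝ) ≤ (⌈X⌉₊ : ℝ) := le_trans hX2 (Nat.le_ceil X)
      exact_mod_cast this
    have hN1 : 1 ≤ N := by rw [hN]; omega
    have hNX : X - 1 ≤ (N : ℝ) := by
      have : ((⌈X⌉₊ - 1 : ℕ) : ℝ) = (⌈X⌉₊ : ℝ) - 1 := by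
        rw [Nat.cast_sub (by omega)]; simp
      rw [hN, this]; linarith only [Nat.le_ceil X]
    have hN0 : (0 : ℝ) < N := by exact_mod_cast hN1
    have hDt0X : (D : ℝ) * Real.log D ^ 519 ≤ X := by
      rw [← ht0eq]
      calc (D : ℝ) * t0 D = 1 * ((D : ℝ) * t0 D) := by ring
        _ ≤ bigT D ^ 10 * ((D : ℝ) * t0 D) :=
            mul_le_mul_of_nonneg_right (one_le_pow₀ hT1) (by linarith only [hDt0])
        _ ≤ X := hXlow.le
    -- (a) Lemma 8.2 core at `x = X = P″₂/d`
    have hxT : Real.exp (Real.log D ^ (11 / 10 : ℝ)) ≤ X := by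
      have : bigT D = Real.exp (Real.log D ^ (11 / 10 : ℝ)) := by
        rw [bigT, hell]; norm_num
      rw [← this]; exact hXT
    have hxP : X ≤ Real.exp (Real.log D ^ 9) := by
      have : bigP D = Real.exp (Real.log D ^ 9) := by rw [bigP, hell]
      rw [← this]; exact hXP
    have hB := Lemma82.sum_twist_log_sub_main_le χ hp hL3 hA' hK0 hK8 hδre hδ hxT hxP
    -- (b1) Lemma 5.8 at `s = 1 + δ`
    have h58 := Lemma58.lemma_5_8_of_le χ hp hL3 hA' (K := K) hK1 (s := 1 + δ)
      (by rw [add_sub_cancel_left]; exact hδ)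
    rw [add_sub_cancel_left] at h58
    -- (b2) the tail of the Dirichlet series of `L(1+δ,χ)`
    have htail := RichertFromExpSum.norm_LFunction_sub_sum_range_le χ hχ1 hs hN1
    rw [hre1, Real.rpow_neg_one, div_one] at htail
    have hDN : (D : ℝ) * (N : ℝ)⁻¹ * (1 + ‖(1 : ℂ) + δ‖) ≤ 6 / Real.log D ^ 519 := by
      have h3 : (1 : ℝ) + ‖(1 : ℂ) + δ‖ ≤ 3 := by linarith only [hn1δ]
      calc (D : ℝ) * (N : ℝ)⁻¹ * (1 + ‖(1 : ℂ) + δ‖) ≤ (D : ℝ) * (N : ℝ)⁻¹ * 3 :=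
            mul_le_mul_of_nonneg_left h3 (by positivity)
        _ = 3 * D / N := by ring
        _ ≤ 6 / Real.log D ^ 519 := by
            rw [div_le_div_iff₀ hN0 (by positivity)]
            linarith only [hDt0X, hNX, hX2]
    have hAeq := sum_Ico_ceil_eq_sum_range χ X δ (rfl : (1 : ℂ) + δ = 1 + δ)
    rw [← hN] at hAeq
    have hAtail : ‖(∑ l ∈ Finset.Ico 1 ⌈X⌉₊, χ (l : ZMod D) / (l : ℂ) ^ (1 + δ)) -
        χ.LFunction (1 + δ)‖ ≤ 6 / Real.log D ^ 519 := by
      rw [norm_sub_rev, hAeq]; exact htail.trans hDN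
    -- the inner comparison
    have key := inner_bound (Λ := 0.004 * Real.log D ^ 9) (by positivity) hAtail h58 hB
    have hL6 : 0 < Real.log D ^ 6 := by positivity
    have key2 : 0.004 * Real.log D ^ 9 * (6 / Real.log D ^ 519 + C58 / Real.log D ^ 15) +
        Lemma82.C82 K / Real.log D ^ 6 ≤ CE / Real.log D ^ 6 := by
      have hsmall : 0.004 * Real.log D ^ 9 * (6 / Real.log D ^ 519) ≤ 1 / Real.log D ^ 6 := by
        rw [show 0.004 * Real.log D ^ 9 * (6 / Real.log D ^ 519) = 0.024 / Real.log D ^ 510 by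
          field_simp; ring]
        rw [div_le_div_iff₀ (by positivity) hL6]
        have : Real.log D ^ 6 ≤ Real.log D ^ 510 := pow_le_pow_right₀ hL1 (by norm_num)
        nlinarith only [this, hL6]
      have hmid : 0.004 * Real.log D ^ 9 * (C58 / Real.log D ^ 15) =
          0.004 * C58 / Real.log D ^ 6 := by
        field_simp
      calc 0.004 * Real.log D ^ 9 * (6 / Real.log D ^ 519 + C58 / Real.log D ^ 15) +
            Lemma82.C82 K / Real.log D ^ 6
          = 0.004 * Real.log D ^ 9 * (6 / Real.log D ^ 519) +
              0.004 * Real.log D ^ 9 * (C58 / Real.log D ^ 15) + Lemma82.C82 K / Real.log D ^ 6 := by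
            ring
        _ ≤ 1 / Real.log D ^ 6 + 0.004 * C58 / Real.log D ^ 6 + Lemma82.C82 K / Real.log D ^ 6 := by
            rw [hmid]; linarith only [hsmall]
        _ = CE / Real.log D ^ 6 := by rw [hCE]; ring
    -- the prefactor has norm `1/log P₁ = 1/(0.504 𝓛⁹)`
    have hcd : ‖(((d : ℝ) / P1pp D : ℝ) : ℂ) ^ (-beta6 D)‖ = 1 := by
      rw [Complex.norm_cpow_eq_rpow_re_of_pos hdP, Complex.neg_re, hβ6re, neg_zero,
        Real.rpow_zero]
    have hlP : ‖(Real.log (Skeleton.P1 D) : ℂ)‖ = 0.504 * Real.log D ^ 9 := by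
      rw [Complex.norm_real, Real.norm_eq_abs, hlogP1, abs_of_pos (by positivity)]
    -- assemble
    rw [line020_eq_mul, ← hX, he', ← hδdef, ← hu, sum_log_eq_log_mul_sub_twist χ hX0 δ rfl]
    have hm : deriv χ.LFunction 1 * (((d : ℝ) / P1pp D : ℝ) : ℂ) ^ (-beta6 D) /
          (Real.log (Skeleton.P1 D) : ℂ) * (-1 + δ * (u : ℂ)) =
        (((d : ℝ) / P1pp D : ℝ) : ℂ) ^ (-beta6 D) / (Real.log (Skeleton.P1 D) : ℂ) *
          (deriv χ.LFunction 1 * (-1 + δ * (u : ℂ))) := by ring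
    rw [hm, ← mul_sub, norm_mul, inner_identity _ _ _ _ hΛ, norm_div, hcd, hlP, hell]
    calc 1 / (0.504 * Real.log D ^ 9) *
          ‖((0.004 * Real.log D ^ 9 : ℝ) : ℂ) *
              ((∑ l ∈ Finset.Ico 1 ⌈X⌉₊, χ (l : ZMod D) / (l : ℂ) ^ (1 + δ)) -
                deriv χ.LFunction 1 * δ) -
            ((∑ m ∈ Finset.Ioc 0 ⌊X⌋₊, Lemma82.twist χ δ m * (Real.log (X / m) : ℂ)) -
              deriv χ.LFunction 1 * (1 + δ * (Real.log X : ℂ)))‖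
        ≤ 1 / (0.504 * Real.log D ^ 9) * (CE / Real.log D ^ 6) :=
          mul_le_mul_of_nonneg_left (key.trans key2) (by positivity)
      _ = CE / 0.504 * (Real.log D ^ 15)⁻¹ := by field_simp

end StepThree

/-! ### The closed form of the first line for every `1 ≤ d < P₂` (not only `d > P″₁`) -/

section ClosedForm

variable (c' : ℝ)

/-- **The first displayed line in closed form, for ALL `1 ≤ d < P₂`** (under (A), `j ∈ {1,2,3}`):
`‖line020(d) − (L′(1,χ)(d/P″₁)^{−β₆}/log P₁)(−1 + (β₆ − β_j)log(d/P″₁))‖ ≤ C𝓛⁻¹⁵`. This is the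
estimate inside `U020_holds` (ii) with the single change that `X = P″₂/d ≤ P` is taken from
`d ≥ 1` (`P″₂ = P^{1/2}Dt₀ ≤ P`) instead of `d > P″₁`; it is the input for the range
`P″₁/T < d ≤ P″₁` of Lemma 12.1, where the `l`-sum equals `line020(d)` minus its head `l ≤ P″₁/d`.
[cite: Zhang2022LandauSiegel, §12 proof of Lemma 12.1, p. 68] -/
theorem line020_closed_form : ∃ C : ℝ, ForAllLarge fun D _ χ => AssumptionA D χ →
    ∀ j ∈ ({1, 2, 3} : Finset ℕ), ∀ d : ℕ, 1 ≤ d → (d : ℝ) < Skeleton.P2 D →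
      ‖line020 c' χ j d -
          deriv χ.LFunction 1 * ((d / P1pp D : ℝ) : ℂ) ^ (-beta6 D) /
              (Real.log (Skeleton.P1 D) : ℂ) *
            (-1 + (beta6 D - betaJ c' D j) * (Real.log (d / P1pp D) : ℂ))‖ ≤
        C * (ell D ^ 15)⁻¹ := by
  set K : ℝ := 2 * (3 + 5 * |c'|) with hKdef
  have hK0 : 0 ≤ K := by rw [hKdef]; positivity
  set C58 : ℝ := 1 + 16 * Real.exp (9 / 2) * π ^ 2 * K ^ 2 with hC58
  set CE : ℝ := 0.004 * C58 + 1 + Lemma82.C82 K with hCE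
  refine ⟨CE / 0.504, ⌈Real.exp (4 * K * π + 3)⌉₊,
    fun D _ χ hD hq hp hA j hj d hd hd2 => ?_⟩
  have hπ := Real.pi_pos
  -- `D` large: `𝓛 ≥ 3`, `4Kπ ≤ 𝓛 ≤ 𝓛⁸`
  have hD0 : (0 : ℝ) < D := lt_of_lt_of_le (Real.exp_pos _)
    (le_trans (Nat.le_ceil _) (by exact_mod_cast hD))
  have hexp : Real.exp (4 * K * π + 3) ≤ D := le_trans (Nat.le_ceil _) (by exact_mod_cast hD)
  have hlogD : 4 * K * π + 3 ≤ Real.log D := (Real.le_log_iff_exp_le hD0).mpr hexp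
  have hKπ : 0 ≤ 4 * K * π := by positivity
  have hL3 : 3 ≤ Real.log D := by linarith only [hlogD, hKπ]
  have hL1 : 1 ≤ Real.log D := by linarith only [hL3]
  have hL0 : 0 < Real.log D := by linarith only [hL3]
  have hK8 : 4 * K * π ≤ Real.log D ^ 8 := by
    calc 4 * K * π ≤ Real.log D := by linarith only [hlogD]
      _ = Real.log D ^ 1 := (pow_one _).symm
      _ ≤ Real.log D ^ 8 := pow_le_pow_right₀ hL1 (by norm_num)
  have hK1 : K * π ≤ Real.log D ^ 8 := by nlinarith only [hK8, hK0, hπ]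
  have hD3 : 3 ≤ D := by
    have h3 : Real.exp 3 ≤ Real.exp (4 * K * π + 3) := Real.exp_le_exp.mpr (by linarith only [hKπ])
    have h4 : (3 : ℝ) + 1 ≤ Real.exp 3 := Real.add_one_le_exp 3
    have : (3 : ℝ) ≤ D := by linarith only [h3, h4, hexp]
    exact_mod_cast this
  have hD2 : 2 ≤ D := le_trans (by norm_num) hD3
  have hχ1 : χ ≠ 1 := Lemma31.ne_one_of_isPrimitive χ hD2 hp
  have hA' : ‖χ.LFunction 1‖ ≤ 1 / Real.log D ^ 2022 := le_of_lt hA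
  have hell : ell D = Real.log D := rfl
  have hC82 : 0 ≤ Lemma82.C82 K := by
    have := Lemma82.I0_nonneg
    rw [Lemma82.C82]; positivity
  have hCE0 : 0 ≤ CE := by rw [hCE]; positivity
  -- the closed form (the body of `U020_holds` (ii), with `X ≤ P` from `d ≥ 1` instead of `d > P″₁`)
  -- parameters of the setting
  have hα : alpha D = π / Real.log D ^ 9 := by rw [alpha, bigP, Real.log_exp, hell]
  have hP : 0 < bigP D := Real.exp_pos _
  have hP1' : 1 ≤ bigP D := Real.one_le_exp (by rw [hell]; positivity)
  have hlogP1 : Real.log (Skeleton.P1 D) = 0.504 * Real.log D ^ 9 := by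
    rw [Skeleton.P1, Real.log_rpow hP, bigP, Real.log_exp, hell]
  have hP1pp : 0 < P1pp D := P1pp_pos hD3
  have hP2pp : 0 < P2pp D := P2pp_pos hD3
  have hd0 : (0 : ℝ) < d := by exact_mod_cast hd
  have hDr : (3 : ℝ) ≤ D := by exact_mod_cast hD3
  have ht0 : 1 ≤ t0 D := by rw [t0, hell]; exact one_le_pow₀ hL1
  have ht0eq : t0 D = Real.log D ^ 519 := by rw [t0, hell]
  have hT1 : 1 ≤ bigT D := Real.one_le_exp (by rw [hell]; positivity)
  have hT2 : 2 ≤ bigT D := by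
    have h1 : (1 : ℝ) ≤ Real.log D ^ (1.1 : ℝ) := Real.one_le_rpow hL1 (by norm_num)
    have h2 : Real.exp 1 ≤ Real.exp (Real.log D ^ (1.1 : ℝ)) := Real.exp_le_exp.mpr h1
    have h3 : (1 : ℝ) + 1 ≤ Real.exp 1 := Real.add_one_le_exp 1
    rw [bigT, hell]; linarith only [h2, h3]
  have hDt0 : 1 ≤ (D : ℝ) * t0 D := one_le_mul_of_one_le_of_one_le (by linarith only [hDr]) ht0
  obtain ⟨X, hX⟩ : ∃ X : ℝ, X = P2pp D / d := ⟨_, rfl⟩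
  have hXlow : bigT D ^ 10 * ((D : ℝ) * t0 D) < X := by
    have h1 : (d : ℝ) * bigT D ^ 10 < bigP D ^ (0.5 : ℝ) := by
      have := hd2
      rw [Skeleton.P2, lt_div_iff₀ (by positivity)] at this
      exact this
    rw [hX, lt_div_iff₀ hd0, P2pp]
    have hpos : (0 : ℝ) < (D : ℝ) * t0 D := by linarith only [hDt0]
    calc bigT D ^ 10 * ((D : ℝ) * t0 D) * d = ((d : ℝ) * bigT D ^ 10) * ((D : ℝ) * t0 D) := by
          ring
      _ < bigP D ^ (0.5 : ℝ) * ((D : ℝ) * t0 D) := mul_lt_mul_of_pos_right h1 hpos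
      _ = bigP D ^ (0.5 : ℝ) * D * t0 D := by ring
  have hXT : bigT D ≤ X := by
    calc bigT D = bigT D ^ 1 * 1 := by ring
      _ ≤ bigT D ^ 10 * ((D : ℝ) * t0 D) :=
          mul_le_mul (pow_le_pow_right₀ hT1 (by norm_num)) hDt0 zero_le_one (by positivity)
      _ ≤ X := hXlow.le
  have hX2 : 2 ≤ X := le_trans hT2 hXT
  have hX0 : 0 < X := by linarith only [hX2]
  have hratio : P2pp D / P1pp D = bigP D ^ (0.004 : ℝ) := by
    have hne : (D : ℝ) * t0 D ≠ 0 := by positivity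
    have h1 : P2pp D / P1pp D = bigP D ^ (0.5 : ℝ) / bigP D ^ (0.496 : ℝ) := by
      rw [P2pp, P1pp, mul_assoc, mul_assoc, mul_div_mul_right _ _ hne]
    rw [h1, ← Real.rpow_sub hP]
    norm_num
  have hXP : X ≤ bigP D := by
    -- `X = P″₂/d ≤ P″₂ = P^{1/2}·D·𝓛⁵¹⁹ ≤ P` (`d ≥ 1`, `𝓛 ≥ 3`)
    have h1 : X ≤ P2pp D := by rw [hX]; exact div_le_self hP2pp.le (by exact_mod_cast hd)
    have hlogL : Real.log (Real.log D) ≤ Real.log D := by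
      have := Real.log_le_sub_one_of_pos hL0; linarith only [this]
    have hlogP2pp : Real.log (P2pp D) = 0.5 * Real.log D ^ 9 + Real.log D +
        519 * Real.log (Real.log D) := by
      have ht0' : 0 < t0 D := by rw [t0, hell]; positivity
      rw [P2pp, Real.log_mul (by positivity) ht0'.ne',
        Real.log_mul (Real.rpow_pos_of_pos hP _).ne' hD0.ne', Real.log_rpow hP, bigP, Real.log_exp,
        t0, Real.log_pow, hell]
      push_cast; ring
    have hL9big : 520 * Real.log D ≤ 0.5 * Real.log D ^ 9 := by
      have h8 : (3 : ℝ) ^ 8 ≤ Real.log D ^ 8 := pow_le_pow_left₀ (by norm_num) hL3 8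
      nlinarith only [h8, hL0]
    have h2 : Real.log (P2pp D) ≤ Real.log (bigP D) := by
      rw [hlogP2pp, bigP, Real.log_exp, hell]; nlinarith only [hlogL, hL9big, hL0]
    exact h1.trans ((Real.log_le_log_iff hP2pp hP).mp h2)
  obtain ⟨u, hu⟩ : ∃ u : ℝ, u = Real.log ((d : ℝ) / P1pp D) := ⟨_, rfl⟩
  have hdP : 0 < (d : ℝ) / P1pp D := div_pos hd0 hP1pp
  have hΛ : u + Real.log X = 0.004 * Real.log D ^ 9 := by
    rw [hu, ← Real.log_mul hdP.ne' hX0.ne']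
    have : (d : ℝ) / P1pp D * X = P2pp D / P1pp D := by
      rw [hX]; field_simp
    rw [this, hratio, Real.log_rpow hP, bigP, Real.log_exp, hell]
  -- the shifts
  obtain ⟨δ, hδdef⟩ : ∃ δ : ℂ, δ = beta6 D - betaJ c' D j := ⟨_, rfl⟩
  have he' : 1 + beta6 D - betaJ c' D j = 1 + δ := by rw [hδdef]; ring
  obtain ⟨hβjre, hβjn⟩ := betaJ_re_and_norm c' (by linarith only [hL3]) hj
  have hβ6eq : beta6 D = ((3 / 2 * (π / Real.log D ^ 9) : ℝ) : ℂ) * I := by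
    rw [beta6, hα]; push_cast; ring
  have hβ6re : (beta6 D).re = 0 := by rw [hβ6eq]; exact Lemma82.re_ofReal_mul_I _
  have hβ6n : ‖beta6 D‖ ≤ (3 + 5 * |c'|) * (π / Real.log D ^ 9) := by
    rw [hβ6eq, Lemma82.norm_ofReal_mul_I, abs_of_pos (by positivity)]
    have h0 : 0 ≤ π / Real.log D ^ 9 := by positivity
    have hc0 : 0 ≤ |c'| := abs_nonneg _
    nlinarith only [h0, hc0]
  have hδre : δ.re = 0 := by rw [hδdef, Complex.sub_re, hβ6re, hβjre, sub_zero]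
  have hδ : ‖δ‖ ≤ K * π / Real.log D ^ 9 := by
    rw [hδdef]
    calc ‖beta6 D - betaJ c' D j‖ ≤ ‖beta6 D‖ + ‖betaJ c' D j‖ := norm_sub_le _ _
      _ ≤ (3 + 5 * |c'|) * (π / Real.log D ^ 9) + (3 + 5 * |c'|) * (π / Real.log D ^ 9) :=
          add_le_add hβ6n hβjn
      _ = K * π / Real.log D ^ 9 := by rw [hKdef]; ring
  have hδ1 : ‖δ‖ ≤ 1 := by
    refine hδ.trans ?_
    rw [div_le_one (by positivity)]
    have h9 : Real.log D ^ 8 ≤ Real.log D ^ 9 := pow_le_pow_right₀ hL1 (by norm_num)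
    linarith only [h9, hK1]
  have hre1 : (1 + δ).re = 1 := by
    rw [Complex.add_re, Complex.one_re, hδre, add_zero]
  have hs : 0 < (1 + δ).re := by rw [hre1]; exact one_pos
  have hn1δ : ‖(1 : ℂ) + δ‖ ≤ 2 := by
    have h := norm_add_le (1 : ℂ) δ
    rw [norm_one] at h
    linarith only [h, hδ1]
  -- (b2) `N = ⌈X⌉ − 1 ≥ X − 1 ≥ X/2`, and `X > Dt₀T¹⁰`
  obtain ⟨N, hN⟩ : ∃ N : ℕ, N = ⌈X⌉₊ - 1 := ⟨_, rfl⟩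
  have hceil2 : 2 ≤ ⌈X⌉₊ := by
    have : (2 : ℝ) ≤ (⌈X⌉₊ : ℝ) := le_trans hX2 (Nat.le_ceil X)
    exact_mod_cast this
  have hN1 : 1 ≤ N := by rw [hN]; omega
  have hNX : X - 1 ≤ (N : ℝ) := by
    have : ((⌈X⌉₊ - 1 : ℕ) : ℝ) = (⌈X⌉₊ : ℝ) - 1 := by
      rw [Nat.cast_sub (by omega)]; simp
    rw [hN, this]; linarith only [Nat.le_ceil X]
  have hN0 : (0 : ℝ) < N := by exact_mod_cast hN1
  have hDt0X : (D : ℝ) * Real.log D ^ 519 ≤ X := by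
    rw [← ht0eq]
    calc (D : ℝ) * t0 D = 1 * ((D : ℝ) * t0 D) := by ring
      _ ≤ bigT D ^ 10 * ((D : ℝ) * t0 D) :=
          mul_le_mul_of_nonneg_right (one_le_pow₀ hT1) (by linarith only [hDt0])
      _ ≤ X := hXlow.le
  -- (a) Lemma 8.2 core at `x = X = P″₂/d`
  have hxT : Real.exp (Real.log D ^ (11 / 10 : ℝ)) ≤ X := by
    have : bigT D = Real.exp (Real.log D ^ (11 / 10 : ℝ)) := by
      rw [bigT, hell]; norm_num
    rw [← this]; exact hXT
  have hxP : X ≤ Real.exp (Real.log D ^ 9) := by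
    have : bigP D = Real.exp (Real.log D ^ 9) := by rw [bigP, hell]
    rw [← this]; exact hXP
  have hB := Lemma82.sum_twist_log_sub_main_le χ hp hL3 hA' hK0 hK8 hδre hδ hxT hxP
  -- (b1) Lemma 5.8 at `s = 1 + δ`
  have h58 := Lemma58.lemma_5_8_of_le χ hp hL3 hA' (K := K) hK1 (s := 1 + δ)
    (by rw [add_sub_cancel_left]; exact hδ)
  rw [add_sub_cancel_left] at h58
  -- (b2) the tail of the Dirichlet series of `L(1+δ,χ)`
  have htail := RichertFromExpSum.norm_LFunction_sub_sum_range_le χ hχ1 hs hN1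
  rw [hre1, Real.rpow_neg_one, div_one] at htail
  have hDN : (D : ℝ) * (N : ℝ)⁻¹ * (1 + ‖(1 : ℂ) + δ‖) ≤ 6 / Real.log D ^ 519 := by
    have h3 : (1 : ℝ) + ‖(1 : ℂ) + δ‖ ≤ 3 := by linarith only [hn1δ]
    calc (D : ℝ) * (N : ℝ)⁻¹ * (1 + ‖(1 : ℂ) + δ‖) ≤ (D : ℝ) * (N : ℝ)⁻¹ * 3 :=
          mul_le_mul_of_nonneg_left h3 (by positivity)
      _ = 3 * D / N := by ring
      _ ≤ 6 / Real.log D ^ 519 := by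
          rw [div_le_div_iff₀ hN0 (by positivity)]
          linarith only [hDt0X, hNX, hX2]
  have hAeq := sum_Ico_ceil_eq_sum_range χ X δ (rfl : (1 : ℂ) + δ = 1 + δ)
  rw [← hN] at hAeq
  have hAtail : ‖(∑ l ∈ Finset.Ico 1 ⌈X⌉₊, χ (l : ZMod D) / (l : ℂ) ^ (1 + δ)) -
      χ.LFunction (1 + δ)‖ ≤ 6 / Real.log D ^ 519 := by
    rw [norm_sub_rev, hAeq]; exact htail.trans hDN
  -- the inner comparison
  have key := inner_bound (Λ := 0.004 * Real.log D ^ 9) (by positivity) hAtail h58 hB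
  have hL6 : 0 < Real.log D ^ 6 := by positivity
  have key2 : 0.004 * Real.log D ^ 9 * (6 / Real.log D ^ 519 + C58 / Real.log D ^ 15) +
      Lemma82.C82 K / Real.log D ^ 6 ≤ CE / Real.log D ^ 6 := by
    have hsmall : 0.004 * Real.log D ^ 9 * (6 / Real.log D ^ 519) ≤ 1 / Real.log D ^ 6 := by
      rw [show 0.004 * Real.log D ^ 9 * (6 / Real.log D ^ 519) = 0.024 / Real.log D ^ 510 by
        field_simp; ring]
      rw [div_le_div_iff₀ (by positivity) hL6]
      have : Real.log D ^ 6 ≤ Real.log D ^ 510 := pow_le_pow_right₀ hL1 (by norm_num)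
      nlinarith only [this, hL6]
    have hmid : 0.004 * Real.log D ^ 9 * (C58 / Real.log D ^ 15) =
        0.004 * C58 / Real.log D ^ 6 := by
      field_simp
    calc 0.004 * Real.log D ^ 9 * (6 / Real.log D ^ 519 + C58 / Real.log D ^ 15) +
          Lemma82.C82 K / Real.log D ^ 6
        = 0.004 * Real.log D ^ 9 * (6 / Real.log D ^ 519) +
            0.004 * Real.log D ^ 9 * (C58 / Real.log D ^ 15) + Lemma82.C82 K / Real.log D ^ 6 := by
          ring
      _ ≤ 1 / Real.log D ^ 6 + 0.004 * C58 / Real.log D ^ 6 + Lemma82.C82 K / Real.log D ^ 6 := by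
          rw [hmid]; linarith only [hsmall]
      _ = CE / Real.log D ^ 6 := by rw [hCE]; ring
  -- the prefactor has norm `1/log P₁ = 1/(0.504 𝓛⁹)`
  have hcd : ‖(((d : ℝ) / P1pp D : ℝ) : ℂ) ^ (-beta6 D)‖ = 1 := by
    rw [Complex.norm_cpow_eq_rpow_re_of_pos hdP, Complex.neg_re, hβ6re, neg_zero,
      Real.rpow_zero]
  have hlP : ‖(Real.log (Skeleton.P1 D) : ℂ)‖ = 0.504 * Real.log D ^ 9 := by
    rw [Complex.norm_real, Real.norm_eq_abs, hlogP1, abs_of_pos (by positivity)]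
  -- assemble
  rw [line020_eq_mul, ← hX, he', ← hδdef, ← hu, sum_log_eq_log_mul_sub_twist χ hX0 δ rfl]
  have hm : deriv χ.LFunction 1 * (((d : ℝ) / P1pp D : ℝ) : ℂ) ^ (-beta6 D) /
        (Real.log (Skeleton.P1 D) : ℂ) * (-1 + δ * (u : ℂ)) =
      (((d : ℝ) / P1pp D : ℝ) : ℂ) ^ (-beta6 D) / (Real.log (Skeleton.P1 D) : ℂ) *
        (deriv χ.LFunction 1 * (-1 + δ * (u : ℂ))) := by ring
  rw [hm, ← mul_sub, norm_mul, inner_identity _ _ _ _ hΛ, norm_div, hcd, hlP, hell]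
  calc 1 / (0.504 * Real.log D ^ 9) *
        ‖((0.004 * Real.log D ^ 9 : ℝ) : ℂ) *
            ((∑ l ∈ Finset.Ico 1 ⌈X⌉₊, χ (l : ZMod D) / (l : ℂ) ^ (1 + δ)) -
              deriv χ.LFunction 1 * δ) -
          ((∑ m ∈ Finset.Ioc 0 ⌊X⌋₊, Lemma82.twist χ δ m * (Real.log (X / m) : ℂ)) -
            deriv χ.LFunction 1 * (1 + δ * (Real.log X : ℂ)))‖
      ≤ 1 / (0.504 * Real.log D ^ 9) * (CE / Real.log D ^ 6) :=
        mul_le_mul_of_nonneg_left (key.trans key2) (by positivity)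
    _ = CE / 0.504 * (Real.log D ^ 15)⁻¹ := by field_simp

end ClosedForm

end Literature.NumberTheory.LFunctions.Zhang2022.Typed.Sec12B
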